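import Literature.MathematicalPhysics.QuantumFieldTheory.WilsonEnergyConvexity
import Literature.MathematicalPhysics.QuantumFieldTheory.YangMillsOS
import HarnessLib

/-!
# Route `LangevinControlUV`, crux `FemtoCurvatureTwoPointC` (stmt-QuantumFields-16204), line `Sketch` —
# sublevel doubling of Wilson's action ⇒ the second-moment law `⟨S²⟩_{L,β} ≤ K'/β²`

Registered stub `stub_secondMomentOfDoubling` of skeleton v7 (`--supports stmt-QuantumFields-16204`),
proved verbatim. Setting: a compact group `G`, a lattice representation `r` (continuous unitary
`r.ρ : G →* M_N(ℂ)`), the torus `(ℤ/L)⁴`; `S = wilsonAction r.ρ ∈ [0, B]` is Wilson's action,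
`μ = Haar^{⊗E}` the product Haar probability measure on configurations, `V(t) = μ{S ≤ t}` the
sublevel volumes, `Z(β) = ∫ e^{-βS} dμ` and `⟨X⟩_β = ∫ X e^{-βS} dμ / Z(β)`
(`wilsonExpectation_eq_integral_div`).

**Statement.** If `V(t) ≤ K V(t/4)` for `0 < t ≤ t₀` (doubling near `0`), then there are `K', β₀`
with `⟨S²⟩_β ≤ K'/β²` for `β ≥ β₀`.

**Proof (a fixed-torus Laplace estimate; no asymptotics of `Z`).** Take `β₀ = 1/t₀`. For
`β ≥ β₀` pick `N ≥ 1` with `4^{N-1} ≤ β t₀ < 4^N` and put `τ = t₀/4^N`, so `1/4 ≤ βτ < 1` and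
`4^N τ = t₀`. Pointwise in `s = S(U) ∈ [0, B]`, with the blocks `(4^m τ, 4^{m+1} τ]`, `m < N`:

  `s² e^{-βs} ≤ B² e^{-βt₀} + ∑_{m<N} (4^{m+1}τ)² e^{-β 4^m τ} 1{s ≤ 4^{m+1}τ} + τ² 1{s ≤ τ}`,

hence `∫ S² e^{-βS} dμ ≤ B² e^{-βt₀} + ∑_{m<N} (4^{m+1}τ)² e^{-β4^mτ} V(4^{m+1}τ) + τ² V(τ)`.
Each term is `O(Z/β²)` by the Laplace lower bound `Z ≥ e^{-βt} V(t)` (tree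
`exp_mul_measureReal_le_integral_exp`) at a suitable `t`:
* `τ² V(τ) ≤ β^{-2} e^{βτ} Z ≤ e Z/β²`;
* two doubling steps `V(4^{m+1}τ) ≤ K² V(4^{m-1}τ) ≤ K² e^{β 4^{m-1}τ} Z` give the block bound
  `16 K² β^{-2} (4^m)² e^{-(3/4)β 4^m τ} Z ≤ 16 K² β^{-2} (4^m)² e^{-(3/16)4^m} Z`, and
  `(4^m)² e^{-(3/16)4^m} ≤ (4^m)³ e^{-(3/16)4^m} 2^{-m} ≤ 3! (16/3)³ 2^{-m}` sums to `≤ 2·3!(16/3)³`;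
* `B² e^{-βt₀} = B² e^{-(3/4)βt₀} e^{-βt₀/4} ≤ B² · 2/((3/4)t₀ β)² · Z/V(t₀/4)` (`V(t₀/4) > 0`:
  tree `measureReal_wilsonAction_le_pos`).
Dividing by `Z > 0` gives `⟨S²⟩_β ≤ K'/β²` with
`K' = 32B²/(9 t₀² V(t₀/4)) + 32 K² · 6 (16/3)³ + e`.

Contents: `pow_mul_exp_neg_mul_le` (`yⁿe^{-cy} ≤ n!/cⁿ`), `sq_mul_exp_neg_le_geom` (the block
weights against `2^{-m}`), `sq_mul_exp_le_sum_indicator` / `sq_mul_exp_le_majorant` (the pointwise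
step majorant), `integral_sq_mul_exp_le` (its integral), `secondMoment_core_bound` (the real
arithmetic of the three terms), and the stub. All folklore; Mathlib + tree only.
-/

set_option autoImplicit false

noncomputable section

open scoped ENNReal NNReal
open MeasureTheory Literature.MathematicalPhysics.QuantumFieldTheory

namespace Summit.QuantumFields.YangMills.Theorems.FemtoCurvatureTwoPointC

namespace SecondMomentOfDoubling

/-! ### Two elementary real inequalities -/

/-- Exponentials beat powers: `yⁿ e^{-cy} ≤ n!/cⁿ` for `c > 0`, `y ≥ 0`
(from `xⁿ/n! ≤ eˣ` at `x = cy`). [folklore] -/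
theorem pow_mul_exp_neg_mul_le {c y : ℝ} (hc : 0 < c) (hy : 0 ≤ y) (n : ℕ) :
    y ^ n * Real.exp (-(c * y)) ≤ (n.factorial : ℝ) / c ^ n := by
  have h := Real.pow_div_factorial_le_exp (c * y) (mul_nonneg hc.le hy) n
  rw [div_le_iff₀ (by positivity)] at h; rw [le_div_iff₀ (pow_pos hc n)]
  calc y ^ n * Real.exp (-(c * y)) * c ^ n = (c * y) ^ n * Real.exp (-(c * y)) := by ring
    _ ≤ Real.exp (c * y) * n.factorial * Real.exp (-(c * y)) := by gcongr
    _ = n.factorial := by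
        rw [mul_right_comm, ← Real.exp_add, add_neg_cancel, Real.exp_zero, one_mul]

/-- The dyadic block weights are dominated by a geometric sequence:
`(4^m)² e^{-(3/16)4^m} ≤ (6/(3/16)³) · (1/2)^m` (multiply by `2^m ≤ 4^m` and use
`y³ e^{-(3/16)y} ≤ 3!/(3/16)³`). [folklore] -/
theorem sq_mul_exp_neg_le_geom (m : ℕ) :
    ((4 : ℝ) ^ m) ^ 2 * Real.exp (-(3 / 16 * (4 : ℝ) ^ m)) ≤
      6 / (3 / 16 : ℝ) ^ 3 * (1 / 2) ^ m := by
  have h := pow_mul_exp_neg_mul_le (c := 3 / 16) (y := (4 : ℝ) ^ m) (by norm_num) (by positivity) 3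
  rw [show ((Nat.factorial 3 : ℕ) : ℝ) = 6 by norm_num [Nat.factorial]] at h
  have h2 : (2 : ℝ) ^ m ≤ 4 ^ m := pow_le_pow_left₀ (by norm_num) (by norm_num) m
  rw [one_div, inv_pow, ← div_eq_mul_inv, le_div_iff₀ (pow_pos two_pos m)]
  calc ((4 : ℝ) ^ m) ^ 2 * Real.exp (-(3 / 16 * 4 ^ m)) * 2 ^ m
      ≤ ((4 : ℝ) ^ m) ^ 2 * Real.exp (-(3 / 16 * 4 ^ m)) * 4 ^ m := by gcongr
    _ = ((4 : ℝ) ^ m) ^ 3 * Real.exp (-(3 / 16 * 4 ^ m)) := by ring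
    _ ≤ 6 / (3 / 16 : ℝ) ^ 3 := h

/-! ### The pointwise step majorant of `s² e^{-βs}` and its integral -/

section Pointwise

variable {X : Type*} (S : X → ℝ)

/-- On the blocks `(4^m τ, 4^{m+1} τ]`, `m < N`: for `τ < S(x) ≤ 4^N τ`,
`S(x)² e^{-β S(x)} ≤ ∑_{m<N} (4^{m+1}τ)² e^{-β 4^m τ} · 1{S(x) ≤ 4^{m+1}τ}` (the block containing
`S(x)` alone dominates; all terms are non-negative). [folklore] -/
theorem sq_mul_exp_le_sum_indicator {β τ : ℝ} (hβ : 0 ≤ β) (hτ : 0 ≤ τ) (x : X)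
    (hlow : τ < S x) :
    ∀ N : ℕ, S x ≤ 4 ^ N * τ →
      S x ^ 2 * Real.exp (-β * S x) ≤
        ∑ m ∈ Finset.range N, {y | S y ≤ 4 ^ (m + 1) * τ}.indicator
          (fun _ => (4 ^ (m + 1) * τ) ^ 2 * Real.exp (-β * (4 ^ m * τ))) x := by
  intro N
  induction N with
  | zero =>
      intro h
      exact absurd (hlow.trans_le (by simpa using h)) (lt_irrefl _)
  | succ n ih =>
      intro h
      rw [Finset.sum_range_succ]
      by_cases hn : S x ≤ 4 ^ n * τ
      · exact (ih hn).trans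
          (le_add_of_nonneg_right (Set.indicator_nonneg (fun _ _ => by positivity) _))
      · push Not at hn
        have hmem : x ∈ {y | S y ≤ 4 ^ (n + 1) * τ} := h
        rw [Set.indicator_of_mem hmem]
        refine le_add_of_nonneg_of_le
          (Finset.sum_nonneg fun m _ => Set.indicator_nonneg (fun _ _ => by positivity) _) ?_
        have h0 : 0 ≤ S x := hτ.trans hlow.le
        have h1 : S x ^ 2 ≤ (4 ^ (n + 1) * τ) ^ 2 := pow_le_pow_left₀ h0 h 2
        have h2 : Real.exp (-β * S x) ≤ Real.exp (-β * (4 ^ n * τ)) := by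
          rw [Real.exp_le_exp, neg_mul, neg_mul]
          exact neg_le_neg (mul_le_mul_of_nonneg_left hn.le hβ)
        exact mul_le_mul h1 h2 (Real.exp_pos _).le (by positivity)

/-- The full step majorant on `[0, B]`:
`S² e^{-βS} ≤ B² e^{-β 4^N τ} + ∑_{m<N} (4^{m+1}τ)² e^{-β4^mτ} 1{S ≤ 4^{m+1}τ} + τ² 1{S ≤ τ}`
(cases `S ≤ τ`, `τ < S ≤ 4^N τ`, `S > 4^N τ`). [folklore] -/
theorem sq_mul_exp_le_majorant {β τ B : ℝ} (hβ : 0 ≤ β) (hτ : 0 ≤ τ) (N : ℕ) (x : X)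
    (h0 : 0 ≤ S x) (hB : S x ≤ B) :
    S x ^ 2 * Real.exp (-β * S x) ≤
      B ^ 2 * Real.exp (-β * (4 ^ N * τ)) +
        ∑ m ∈ Finset.range N, {y | S y ≤ 4 ^ (m + 1) * τ}.indicator
          (fun _ => (4 ^ (m + 1) * τ) ^ 2 * Real.exp (-β * (4 ^ m * τ))) x +
        {y | S y ≤ τ}.indicator (fun _ => τ ^ 2) x := by
  have hsum : 0 ≤ ∑ m ∈ Finset.range N, {y | S y ≤ 4 ^ (m + 1) * τ}.indicator
      (fun _ => (4 ^ (m + 1) * τ) ^ 2 * Real.exp (-β * (4 ^ m * τ))) x :=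
    Finset.sum_nonneg fun m _ => Set.indicator_nonneg (fun _ _ => by positivity) _
  have hfirst : 0 ≤ B ^ 2 * Real.exp (-β * (4 ^ N * τ)) := by positivity
  have hthird : 0 ≤ {y | S y ≤ τ}.indicator (fun _ => τ ^ 2) x :=
    Set.indicator_nonneg (fun _ _ => by positivity) _
  have hexp1 : Real.exp (-β * S x) ≤ 1 := by
    rw [Real.exp_le_one_iff, neg_mul, neg_nonpos]; exact mul_nonneg hβ h0
  by_cases hlow : S x ≤ τ
  · have hle : S x ^ 2 * Real.exp (-β * S x) ≤ τ ^ 2 :=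
      calc S x ^ 2 * Real.exp (-β * S x) ≤ S x ^ 2 * 1 :=
            mul_le_mul_of_nonneg_left hexp1 (sq_nonneg _)
        _ ≤ τ ^ 2 := by rw [mul_one]; exact pow_le_pow_left₀ h0 hlow 2
    rw [Set.indicator_of_mem (show x ∈ {y | S y ≤ τ} from hlow)]
    linarith
  · push Not at hlow
    by_cases hup : S x ≤ 4 ^ N * τ
    · have := sq_mul_exp_le_sum_indicator S hβ hτ x hlow N hup
      linarith
    · push Not at hup
      have hle : S x ^ 2 * Real.exp (-β * S x) ≤ B ^ 2 * Real.exp (-β * (4 ^ N * τ)) := by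
        refine mul_le_mul (pow_le_pow_left₀ h0 hB 2) ?_ (Real.exp_pos _).le (by positivity)
        rw [Real.exp_le_exp, neg_mul, neg_mul]
        exact neg_le_neg (mul_le_mul_of_nonneg_left hup.le hβ)
      linarith

variable [MeasurableSpace X] (μ : Measure X) [IsProbabilityMeasure μ]

/-- Integrating the step majorant against a probability measure:
`∫ S² e^{-βS} dμ ≤ B² e^{-β4^Nτ} + ∑_{m<N} (4^{m+1}τ)² e^{-β4^mτ} μ{S ≤ 4^{m+1}τ} + τ² μ{S ≤ τ}`
for a measurable `S` with `0 ≤ S ≤ B`. [folklore] -/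
theorem integral_sq_mul_exp_le (hS : Measurable S) {β τ B : ℝ} (hβ : 0 ≤ β) (hτ : 0 ≤ τ)
    (N : ℕ) (h0 : ∀ x, 0 ≤ S x) (hB : ∀ x, S x ≤ B) :
    ∫ x, S x ^ 2 * Real.exp (-β * S x) ∂μ ≤
      B ^ 2 * Real.exp (-β * (4 ^ N * τ)) +
        ∑ m ∈ Finset.range N, (4 ^ (m + 1) * τ) ^ 2 * Real.exp (-β * (4 ^ m * τ)) *
          μ.real {y | S y ≤ 4 ^ (m + 1) * τ} +
        τ ^ 2 * μ.real {y | S y ≤ τ} := by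
  have hmeas : ∀ t : ℝ, MeasurableSet {y | S y ≤ t} := fun t =>
    measurableSet_le hS measurable_const
  have hI1 : Integrable (fun _ : X => B ^ 2 * Real.exp (-β * (4 ^ N * τ))) μ := integrable_const _
  have hI2 : ∀ m ∈ Finset.range N, Integrable (fun x => {y | S y ≤ 4 ^ (m + 1) * τ}.indicator
      (fun _ => (4 ^ (m + 1) * τ) ^ 2 * Real.exp (-β * (4 ^ m * τ))) x) μ :=
    fun m _ => (integrable_const _).indicator (hmeas _)
  have hI2s : Integrable (fun x => ∑ m ∈ Finset.range N, {y | S y ≤ 4 ^ (m + 1) * τ}.indicator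
      (fun _ => (4 ^ (m + 1) * τ) ^ 2 * Real.exp (-β * (4 ^ m * τ))) x) μ :=
    integrable_finsetSum _ hI2
  have hI3 : Integrable (fun x => {y | S y ≤ τ}.indicator (fun _ => τ ^ 2) x) μ :=
    (integrable_const _).indicator (hmeas _)
  have hI12 : Integrable (fun x => B ^ 2 * Real.exp (-β * (4 ^ N * τ)) +
      ∑ m ∈ Finset.range N, {y | S y ≤ 4 ^ (m + 1) * τ}.indicator
        (fun _ => (4 ^ (m + 1) * τ) ^ 2 * Real.exp (-β * (4 ^ m * τ))) x) μ := hI1.add hI2s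
  calc ∫ x, S x ^ 2 * Real.exp (-β * S x) ∂μ
      ≤ ∫ x, (B ^ 2 * Real.exp (-β * (4 ^ N * τ)) +
          ∑ m ∈ Finset.range N, {y | S y ≤ 4 ^ (m + 1) * τ}.indicator
            (fun _ => (4 ^ (m + 1) * τ) ^ 2 * Real.exp (-β * (4 ^ m * τ))) x +
          {y | S y ≤ τ}.indicator (fun _ => τ ^ 2) x) ∂μ := by
        refine integral_mono_of_nonneg (ae_of_all _ fun x => ?_) (hI12.add hI3)
          (ae_of_all _ fun x => ?_)
        · exact mul_nonneg (sq_nonneg _) (Real.exp_pos _).le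
        · exact sq_mul_exp_le_majorant S hβ hτ N x (h0 x) (hB x)
    _ = _ := by
        rw [integral_add hI12 hI3, integral_add hI1 hI2s, integral_finsetSum _ hI2,
          integral_const, probReal_univ, one_smul, integral_indicator_const _ (hmeas _),
          smul_eq_mul, mul_comm (μ.real _) (τ ^ 2)]
        congr 2
        refine Finset.sum_congr rfl fun m _ => ?_
        rw [integral_indicator_const _ (hmeas _), smul_eq_mul, mul_comm]

end Pointwise

/-! ### The real arithmetic of the three terms -/

/-- **Core bound.** With `V ≥ 0` doubling (`V(t) ≤ K V(t/4)`, `0 < t ≤ t₀`), the Laplace lower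
bound `e^{-βt} V(t) ≤ Z` for all `t`, `V(t₀/4) > 0`, `Z > 0`, `4^N τ = t₀`, `1/4 ≤ βτ ≤ 1`, the
majorant `B² e^{-βt₀} + ∑_{m<N} (4^{m+1}τ)² e^{-β4^mτ} V(4^{m+1}τ) + τ² V(τ)` is at most
`(32B²/(9t₀²V(t₀/4)) + 32K²·6/(3/16)³ + e) · Z/β²`. [folklore] -/
theorem secondMoment_core_bound {K t₀ B β τ Z M : ℝ} {N : ℕ} (V : ℝ → ℝ) (hK : 0 ≤ K)
    (ht₀ : 0 < t₀) (hβ : 0 < β) (hτ : 0 < τ) (hNτ : 4 ^ N * τ = t₀) (hβτ1 : β * τ ≤ 1)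
    (hβτ4 : 1 / 4 ≤ β * τ) (hZ : 0 < Z) (hV0 : ∀ t, 0 ≤ V t)
    (hD : ∀ t, 0 < t → t ≤ t₀ → V t ≤ K * V (t / 4))
    (hVZ : ∀ t, Real.exp (-β * t) * V t ≤ Z) (hVpos : 0 < V (t₀ / 4))
    (hM : M ≤ B ^ 2 * Real.exp (-β * t₀) +
      ∑ m ∈ Finset.range N, (4 ^ (m + 1) * τ) ^ 2 * Real.exp (-β * (4 ^ m * τ)) *
        V (4 ^ (m + 1) * τ) +
      τ ^ 2 * V τ) :
    M ≤ (32 * B ^ 2 / (9 * t₀ ^ 2 * V (t₀ / 4)) + 32 * K ^ 2 * (6 / (3 / 16) ^ 3) + Real.exp 1) /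
      β ^ 2 * Z := by
  -- Laplace: `V t ≤ e^{βt} Z`
  have hVZ' : ∀ t, V t ≤ Real.exp (β * t) * Z := fun t => by
    calc V t = Real.exp (β * t) * (Real.exp (-β * t) * V t) := by
          rw [← mul_assoc, ← Real.exp_add, neg_mul, add_neg_cancel, Real.exp_zero, one_mul]
      _ ≤ Real.exp (β * t) * Z := mul_le_mul_of_nonneg_left (hVZ t) (Real.exp_pos _).le
  -- two doubling steps
  have hD2 : ∀ t, 0 < t → t ≤ t₀ → V t ≤ K ^ 2 * V (t / 16) := fun t ht htt => by
    calc V t ≤ K * V (t / 4) := hD t ht htt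
      _ ≤ K * (K * V (t / 4 / 4)) :=
          mul_le_mul_of_nonneg_left (hD (t / 4) (by positivity) (by linarith)) hK
      _ = K ^ 2 * V (t / 16) := by rw [div_div, show (4 : ℝ) * 4 = 16 by norm_num]; ring
  -- `τ² ≤ 1/β²`
  have hτβ : τ ^ 2 ≤ 1 / β ^ 2 := by
    rw [le_div_iff₀ (pow_pos hβ 2), ← mul_pow]
    calc (τ * β) ^ 2 ≤ 1 ^ 2 :=
          pow_le_pow_left₀ (by positivity) (by rw [mul_comm]; exact hβτ1) 2
      _ = 1 := one_pow 2
  -- Term 1: `S > t₀`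
  have hT1 : B ^ 2 * Real.exp (-β * t₀) ≤
      32 * B ^ 2 / (9 * t₀ ^ 2 * V (t₀ / 4)) * (Z / β ^ 2) := by
    have h1 := pow_mul_exp_neg_mul_le (c := 3 / 4 * t₀) (y := β) (by positivity) hβ.le 2
    rw [show ((Nat.factorial 2 : ℕ) : ℝ) = 2 by norm_num [Nat.factorial]] at h1
    have he1 : Real.exp (-(3 / 4 * t₀ * β)) ≤ 2 / (3 / 4 * t₀) ^ 2 / β ^ 2 := by
      rw [le_div_iff₀ (pow_pos hβ 2), mul_comm]; exact h1
    have he2 : Real.exp (-β * (t₀ / 4)) ≤ Z / V (t₀ / 4) := by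
      rw [le_div_iff₀ hVpos]; exact hVZ _
    have hsplit : Real.exp (-β * t₀) =
        Real.exp (-(3 / 4 * t₀ * β)) * Real.exp (-β * (t₀ / 4)) := by
      rw [← Real.exp_add]; congr 1; ring
    rw [hsplit]
    calc B ^ 2 * (Real.exp (-(3 / 4 * t₀ * β)) * Real.exp (-β * (t₀ / 4)))
        ≤ B ^ 2 * (2 / (3 / 4 * t₀) ^ 2 / β ^ 2 * (Z / V (t₀ / 4))) :=
          mul_le_mul_of_nonneg_left (mul_le_mul he1 he2 (Real.exp_pos _).le (by positivity))
            (sq_nonneg _)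
      _ = 32 * B ^ 2 / (9 * t₀ ^ 2 * V (t₀ / 4)) * (Z / β ^ 2) := by ring
  -- Term 2: the blocks
  have hT2 : ∑ m ∈ Finset.range N, (4 ^ (m + 1) * τ) ^ 2 * Real.exp (-β * (4 ^ m * τ)) *
        V (4 ^ (m + 1) * τ) ≤ 32 * K ^ 2 * (6 / (3 / 16) ^ 3) * (Z / β ^ 2) := by
    have hterm : ∀ m ∈ Finset.range N,
        (4 ^ (m + 1) * τ) ^ 2 * Real.exp (-β * (4 ^ m * τ)) * V (4 ^ (m + 1) * τ) ≤
          16 * K ^ 2 * (Z / β ^ 2) * (6 / (3 / 16) ^ 3 * (1 / 2) ^ m) := by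
      intro m hm
      have hmN : m + 1 ≤ N := Finset.mem_range.1 hm
      have htpos : (0 : ℝ) < 4 ^ (m + 1) * τ := by positivity
      have ht_le : (4 : ℝ) ^ (m + 1) * τ ≤ t₀ := by
        rw [← hNτ]
        exact mul_le_mul_of_nonneg_right (pow_le_pow_right₀ (by norm_num) hmN) hτ.le
      have hVt : V (4 ^ (m + 1) * τ) ≤ K ^ 2 * (Real.exp (β * (4 ^ (m + 1) * τ / 16)) * Z) :=
        (hD2 _ htpos ht_le).trans (mul_le_mul_of_nonneg_left (hVZ' _) (pow_nonneg hK 2))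
      have hexp : Real.exp (-β * (4 ^ m * τ)) * Real.exp (β * (4 ^ (m + 1) * τ / 16)) ≤
          Real.exp (-(3 / 16 * 4 ^ m)) := by
        rw [← Real.exp_add, Real.exp_le_exp]
        have h4m : (0 : ℝ) ≤ 4 ^ m := by positivity
        have hid : -β * (4 ^ m * τ) + β * (4 ^ (m + 1) * τ / 16) = -(3 / 4 * (β * τ) * 4 ^ m) := by
          rw [pow_succ]; ring
        rw [hid]
        have := mul_le_mul_of_nonneg_right hβτ4 h4m
        nlinarith
      calc (4 ^ (m + 1) * τ) ^ 2 * Real.exp (-β * (4 ^ m * τ)) * V (4 ^ (m + 1) * τ)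
          ≤ (4 ^ (m + 1) * τ) ^ 2 * Real.exp (-β * (4 ^ m * τ)) *
              (K ^ 2 * (Real.exp (β * (4 ^ (m + 1) * τ / 16)) * Z)) :=
            mul_le_mul_of_nonneg_left hVt (by positivity)
        _ = 16 * K ^ 2 * Z * τ ^ 2 * ((4 ^ m) ^ 2 *
              (Real.exp (-β * (4 ^ m * τ)) * Real.exp (β * (4 ^ (m + 1) * τ / 16)))) := by ring
        _ ≤ 16 * K ^ 2 * Z * (1 / β ^ 2) * ((4 ^ m) ^ 2 * Real.exp (-(3 / 16 * 4 ^ m))) := by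
            gcongr
        _ ≤ 16 * K ^ 2 * Z * (1 / β ^ 2) * (6 / (3 / 16) ^ 3 * (1 / 2) ^ m) :=
            mul_le_mul_of_nonneg_left (sq_mul_exp_neg_le_geom m) (by positivity)
        _ = 16 * K ^ 2 * (Z / β ^ 2) * (6 / (3 / 16) ^ 3 * (1 / 2) ^ m) := by ring
    calc ∑ m ∈ Finset.range N, (4 ^ (m + 1) * τ) ^ 2 * Real.exp (-β * (4 ^ m * τ)) *
          V (4 ^ (m + 1) * τ)
        ≤ ∑ m ∈ Finset.range N, 16 * K ^ 2 * (Z / β ^ 2) * (6 / (3 / 16) ^ 3 * (1 / 2) ^ m) :=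
          Finset.sum_le_sum hterm
      _ = 16 * K ^ 2 * (Z / β ^ 2) * (6 / (3 / 16) ^ 3) *
            ∑ m ∈ Finset.range N, (1 / 2 : ℝ) ^ m := by
          rw [Finset.mul_sum]
          exact Finset.sum_congr rfl fun m _ => by ring
      _ ≤ 16 * K ^ 2 * (Z / β ^ 2) * (6 / (3 / 16) ^ 3) * 2 :=
          mul_le_mul_of_nonneg_left (sum_geometric_two_le N) (by positivity)
      _ = 32 * K ^ 2 * (6 / (3 / 16) ^ 3) * (Z / β ^ 2) := by ring
  -- Term 3: `S ≤ τ`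
  have hT3 : τ ^ 2 * V τ ≤ Real.exp 1 * (Z / β ^ 2) := by
    have h1 : V τ ≤ Real.exp 1 * Z :=
      (hVZ' τ).trans (mul_le_mul_of_nonneg_right (Real.exp_le_exp.2 hβτ1) hZ.le)
    calc τ ^ 2 * V τ ≤ 1 / β ^ 2 * (Real.exp 1 * Z) := mul_le_mul hτβ h1 (hV0 τ) (by positivity)
      _ = Real.exp 1 * (Z / β ^ 2) := by ring
  calc M ≤ _ := hM
    _ ≤ 32 * B ^ 2 / (9 * t₀ ^ 2 * V (t₀ / 4)) * (Z / β ^ 2) +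
          32 * K ^ 2 * (6 / (3 / 16) ^ 3) * (Z / β ^ 2) + Real.exp 1 * (Z / β ^ 2) :=
        add_le_add_three hT1 hT2 hT3
    _ = _ := by ring

end SecondMomentOfDoubling

open SecondMomentOfDoubling

/-- **Sublevel doubling ⇒ second-moment law** (registered stub `stub_secondMomentOfDoubling` of
line `Sketch`, crux `FemtoCurvatureTwoPointC`, stmt-QuantumFields-16204). On a fixed torus
`(ℤ/L)⁴`: if the product-Haar volumes of the sublevel sets of Wilson's action double near `0`
(`Haar^{⊗E}{S ≤ t} ≤ K · Haar^{⊗E}{S ≤ t/4}` for `0 < t ≤ t₀`), then `⟨S²⟩_{L,β} ≤ K'/β²` for all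
`β ≥ 1/t₀`, with `K' = 32B²/(9t₀² Haar^{⊗E}{S ≤ t₀/4}) + 32K²·6(16/3)³ + e` (`|S| ≤ B`). Proof:
the step majorant of `s² e^{-βs}` on the blocks `(4^m τ, 4^{m+1}τ]` (`τ = t₀/4^N ∈ [1/(4β), 1/β]`),
two doubling steps per block and the Laplace lower bound `Z(β) ≥ e^{-βt} Haar^{⊗E}{S ≤ t}`; see the
module docstring. [folklore] -/
theorem stub_secondMomentOfDoubling :
    ∀ (G : Type) [Group G] [TopologicalSpace G] [IsTopologicalGroup G] [CompactSpace G]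
      [MeasurableSpace G] [BorelSpace G] (r : LatticeRep G) (L : ℕ) [NeZero L],
      (∃ (K : ℝ≥0) (t₀ : ℝ), 0 < t₀ ∧ ∀ t : ℝ, 0 < t → t ≤ t₀ →
          Measure.pi (fun _ : Edge 4 L => haarProbability G)
              {U : GaugeConfig 4 L G | wilsonAction r.ρ U ≤ t} ≤
            K * Measure.pi (fun _ : Edge 4 L => haarProbability G)
              {U : GaugeConfig 4 L G | wilsonAction r.ρ U ≤ t / 4}) →
      ∃ (K' β₀ : ℝ), ∀ β : ℝ, β₀ ≤ β →
        wilsonExpectation r.ρ β (fun U : GaugeConfig 4 L G => wilsonAction r.ρ U ^ 2) ≤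
          K' / β ^ 2 := by
  intro G _ _ _ _ _ _ r L _ hyp
  obtain ⟨K, t₀, ht₀, hK⟩ := hyp
  have hρ := r.continuous
  -- the action: measurable, `0 ≤ S ≤ B`
  have hSm : Measurable (wilsonAction (d := 4) (L := L) r.ρ) :=
    WilsonRP.measurable_wilsonAction r.ρ hρ
  have hρN : ∀ g, (r.ρ g).trace.re ≤ r.N := fun g => by
    have h := Literature.RepresentationTheory.CompactGroups.CompactGroup.abs_re_trace_le_card
      r.ρ hρ g
    rw [Fintype.card_fin] at h
    exact (abs_le.1 h).2
  have hS0 : ∀ U : GaugeConfig 4 L G, 0 ≤ wilsonAction r.ρ U := fun U =>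
    wilsonAction_nonneg_of_re_trace_le r.ρ hρN U
  obtain ⟨B, hB⟩ := exists_abs_wilsonAction_le (d := 4) (L := L) r.ρ hρ
  have hSB : ∀ U : GaugeConfig 4 L G, wilsonAction r.ρ U ≤ B := fun U =>
    (le_abs_self _).trans (hB U)
  -- the sublevel volumes (real-valued) and their doubling
  set μ : Measure (GaugeConfig 4 L G) := Measure.pi fun _ : Edge 4 L => haarProbability G with hμ
  have hD : ∀ t, 0 < t → t ≤ t₀ →
      μ.real {U : GaugeConfig 4 L G | wilsonAction r.ρ U ≤ t} ≤
        (K : ℝ) * μ.real {U : GaugeConfig 4 L G | wilsonAction r.ρ U ≤ t / 4} := by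
    intro t ht htt
    have h := hK t ht htt
    have hne : (K : ℝ≥0∞) * μ {U : GaugeConfig 4 L G | wilsonAction r.ρ U ≤ t / 4} ≠ ∞ :=
      ENNReal.mul_ne_top ENNReal.coe_ne_top (measure_ne_top _ _)
    have h' := ENNReal.toReal_mono hne h
    rw [ENNReal.toReal_mul, ENNReal.coe_toReal] at h'
    rw [measureReal_def, measureReal_def]
    exact h'
  have hVpos : 0 < μ.real {U : GaugeConfig 4 L G | wilsonAction r.ρ U ≤ t₀ / 4} :=
    measureReal_wilsonAction_le_pos r.ρ hρ (by positivity)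
  refine ⟨32 * B ^ 2 / (9 * t₀ ^ 2 * μ.real {U : GaugeConfig 4 L G | wilsonAction r.ρ U ≤ t₀ / 4}) +
      32 * (K : ℝ) ^ 2 * (6 / (3 / 16) ^ 3) + Real.exp 1, 1 / t₀, fun β hβ => ?_⟩
  -- the scale `τ = t₀/4^N ∈ [1/(4β), 1/β]`
  have hβpos : 0 < β := lt_of_lt_of_le (by positivity) hβ
  have hβt : 1 ≤ β * t₀ := by rwa [div_le_iff₀ ht₀] at hβ
  obtain ⟨n, hn1, hn2⟩ := exists_nat_pow_near hβt (by norm_num : (1 : ℝ) < 4)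
  set N : ℕ := n + 1 with hN
  have h4N : (0 : ℝ) < 4 ^ N := by positivity
  set τ : ℝ := t₀ / 4 ^ N with hτ_def
  have hτpos : 0 < τ := div_pos ht₀ h4N
  have hNτ : 4 ^ N * τ = t₀ := mul_div_cancel₀ _ h4N.ne'
  have hβτ1 : β * τ ≤ 1 := by
    rw [hτ_def, mul_div_assoc', div_le_one h4N]
    exact hn2.le
  have hβτ4 : 1 / 4 ≤ β * τ := by
    rw [hτ_def, mul_div_assoc', le_div_iff₀ h4N, hN, pow_succ]
    linarith
  -- `Z > 0`, the Laplace lower bound, the integrated majorant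
  have hZpos : 0 < ∫ U, Real.exp (-β * wilsonAction r.ρ U) ∂μ :=
    integral_exp_neg_mul_wilsonAction_pos r.ρ hρ β
  have hVZ : ∀ t, Real.exp (-β * t) * μ.real {U : GaugeConfig 4 L G | wilsonAction r.ρ U ≤ t} ≤
      ∫ U, Real.exp (-β * wilsonAction r.ρ U) ∂μ := fun t =>
    exp_mul_measureReal_le_integral_exp r.ρ hρ hβpos.le t
  have hmain := integral_sq_mul_exp_le (wilsonAction r.ρ) μ hSm (B := B) hβpos.le hτpos.le N hS0 hSB
  rw [hNτ] at hmain
  have key := secondMoment_core_bound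
    (fun t => μ.real {U : GaugeConfig 4 L G | wilsonAction r.ρ U ≤ t}) K.coe_nonneg ht₀ hβpos
    hτpos hNτ hβτ1 hβτ4 hZpos (fun _ => measureReal_nonneg) hD hVZ hVpos hmain
  rw [wilsonExpectation_eq_integral_div r.ρ hρ β, div_le_iff₀ hZpos]
  exact key

end Summit.QuantumFields.YangMills.Theorems.FemtoCurvatureTwoPointC

end
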